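/-
Copyright: statement-level skeleton of a published paper (lit-balaban cell, Phase-2 proof seat p25, gen 17). No proof
claims beyond what the kernel checks below.
-/
import Literature.MathematicalPhysics.QuantumFieldTheory.BalabanImbrieJaffe1984to88.BIJ88LabelledSumBounds312

/-!
# `BalabanImbrieJaffe1984to88.BIJ88LabelledRemainderFieldLaw312` — T. Bałaban, J. Imbrie, A. Jaffe, *Effective action and
cluster properties of the abelian Higgs model*, Commun. Math. Phys. **114** (1988) 257–315 [BalabanImbrieJaffe1988],
§5.14 p. 312 [PDF 56]: *"Summing all terms in X_r gives an observable F_{k,rem}(X_r)."* and *"By performing sufficiently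
many integrations by parts, we have arranged for enough small factors to beat these large factors in the remainder
terms"* — **THE REMAINDER BOUNDS ON THE LAW OF THE FIELDS (the model of record of §5.13–5.14).**  The sibling
`BIJ88LabelledSumBounds312` (p25 gen 17) bounds the remainder observable `remv(O)` of the labelled expansion against the
UNNORMALIZED Gaussian `e^{−½⟨φ,Aφ⟩+⟨ℱ,φ⟩}dφ`, with the shell factor `√μ(Sh)` an unnormalized mass.  On p36's law
`fieldLaw blk Δ ℱ W` (precision `prec blk Δ W (corner ℝ W)`, source `src blk ℱ W`, normalization `Z > 0`) the same
statements hold NORMALIZED: the `χ′` small factor becomes `√ℙ_W(Sh)` — the probability of the large-field shell under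
the law — and the large factors `G`, `G_s` bound expectations `𝔼_W`: `abs_integral_fieldLaw_le_shell` (Cauchy–Schwarz on
the law) and `abs_remv_le_fieldLaw` (`|Σ_{t: no block} coef_t 𝔼_W[Π_{legs of t's X_r}Φ·(Π_{dirs t}∂)χ·e^{−V}]| ≤
(W·max B 1)^{Φ₀(O)} · max(c_M^{M}·G, G_s·√ℙ_W(Sh))`).

statement-level skeleton of published theorems with citation tags; proofs where landed; nothing here is a claim
about the Yang–Mills mass gap

PDF held: `paper:balaban1988-cmp114-bij-abelian-higgs-effective-action` (journal page = PDF page + 256); p. 312 = PDF 56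
(`p0056.txt` L5 / L23–25 re-read this session; the quoted sentences are verbatim there up to the OCR of
sub/superscripts).

CITATION HEADER (lean-in-tree rule).  lit-balaban cell (HOME `run/shared/lean/pub/lit-balaban/`), Phase 2, seat p25
gen 17; row **C2.Claim@312** of `HOME/lit-balaban-r16/ROWS-C2-part2.md` (owner r16, referee ref-5; head
`BIJ88Sect5StatementsPart4.Ineq312` NOT touched — a MEMBER on the model of record).  USED BY NAME, nothing restated:
`BIJ88SlotMomentsGauss308` (`fieldLaw`, `integral_fieldLaw`, `integral_density_pos`; p36), `BIJ88PolymerRep5134Gauss`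
(`prec`, `src`), `BIJ88LabelledSumBounds312.abs_remv_le`, `BIJ88LabelledCoefBound312.abs_gintM_le_shell`,
`BIJ88LabelledExpansion311` (`expand`, `gintM`, `tval`), `BIJ88Resummation312.remv`.

## What is proved (0 `sorry`, standard axioms, no definitions, no `Prop` facts)

* `gintM_eq_integral_prod` (the multiset Gaussian integral written with `Π_{w∈P}⟨φ,w⟩`), `gintM_eq_mul_integral_fieldLaw`
  (`= Z · 𝔼_W[…]`), **`abs_integral_fieldLaw_le_shell`**, `remv_div_eq_sum_fieldLaw`, **`abs_remv_le_fieldLaw`**.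
HONEST SCOPE: as in `BIJ88LabelledSumBounds312` (contraction-graph components, one covariance, crude counts, one small
factor per term); `ℙ_W(Sh)`, `𝔼_W`-moments, `G`, `G_s` not estimated here (the shell tails are p36's `SlotMoments`
business).  CURRENCY: feeds none of `BIJ88Sect5StatementsPart4.Ineq312` / `hobs` / `RemainderComponent` by name.  NOT
summit progress; NOT continuum; NOT Clay.  Imports `BIJ88LabelledSumBounds312` only; modifies nothing.
-/

noncomputable section

namespace Literature.MathematicalPhysics.QuantumFieldTheory.BalabanImbrieJaffe1984to88.BIJ88LabelledRemainderFieldLaw312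

open Classical MeasureTheory Matrix Finset
open scoped BigOperators ContDiff
open Literature.MathematicalPhysics.QuantumFieldTheory.Balaban1983to89
open B2Eq228Conditioning (weight source)
open BIJ88PolymerRep5134 (corner)
open BIJ88PolymerRep5134Gauss (prec src)
open BIJ88SlotMomentsGauss308 (fieldLaw integral_fieldLaw integral_density_pos)
open BIJ88VertexIbp311 (lmono vexp)
open BIJ88WickDerivatives305 (dlist)
open BIJ88VertexComponents311 (Grp maxArity)
open BIJ88VertexComponentsExpansion311 (gint)
open BIJ88LabelledRun311 BIJ88LabelledExpansion311 BIJ88LabelledRemainderCount312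
open BIJ88Resummation312 (remv)
open BIJ88LabelledCoefBound312 BIJ88LabelledTermCount312 BIJ88LabelledSumBounds312

/-! ## §1  The multiset Gaussian integral on the law -/

section General

variable {S : Type} [Fintype S] [DecidableEq S] {ι : Type} [Fintype ι]

omit [DecidableEq S] in
/-- The multiset Gaussian integral written with the product `Π_{w∈P}⟨φ,w⟩` (bookkeeping).
[cite: BalabanImbrieJaffe1988, §5.14 p.311] -/
theorem gintM_eq_integral_prod (A : Matrix S S ℝ) (f : S → ℝ) (c : ι → ℝ) (legs : ι → List (S → ℝ))
    (χ : (S → ℝ) → ℝ) (P : Multiset (S → ℝ)) (D : List (S → ℝ)) :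
    gintM A f c legs χ P D
      = ∫ φ, (P.map fun w => φ ⬝ᵥ w).prod * (dlist D χ φ * vexp c legs φ) * (weight A φ * source f φ) := by
  induction P using Quot.ind with
  | mk L =>
    simp only [Multiset.quot_mk_to_coe'', gintM_coe, Multiset.map_coe, Multiset.prod_coe]
    rfl

end General

section Law

variable {ι : Type} [Fintype ι] {κ : Type} [LinearOrder κ]
variable {α I : Type} [Fintype α] [DecidableEq α] [Fintype I] [DecidableEq I]
  (blk : α → I) (Δ : Matrix α α ℝ) (ℱ : α → ℝ) (W : Finset I)

/-- **The unnormalized integral is `Z` times the expectation on the law**: `gintM P D = Z · 𝔼_W[Π_PΦ·(Π_D∂)χ·e^{−V}]`.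
[cite: BalabanImbrieJaffe1988, (5.14.3) p.309] -/
theorem gintM_eq_mul_integral_fieldLaw (hPD : (prec blk Δ W (corner ℝ W)).PosDef) (c : ι → ℝ)
    (legs : ι → List ({x : α // blk x ∈ W} → ℝ)) (χ : ({x : α // blk x ∈ W} → ℝ) → ℝ)
    (P : Multiset ({x : α // blk x ∈ W} → ℝ)) (D : List ({x : α // blk x ∈ W} → ℝ)) :
    gintM (prec blk Δ W (corner ℝ W)) (src blk ℱ W) c legs χ P D
      = (∫ φ, weight (prec blk Δ W (corner ℝ W)) φ * source (src blk ℱ W) φ)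
        * ∫ φ, (P.map fun w => φ ⬝ᵥ w).prod * (dlist D χ φ * vexp c legs φ) ∂(fieldLaw blk Δ ℱ W) := by
  rw [integral_fieldLaw, gintM_eq_integral_prod, mul_div_cancel₀ _ (integral_density_pos blk Δ ℱ W hPD).ne']

/-- **THE `χ′` SMALL FACTOR ON THE LAW** (Cauchy–Schwarz in `L²(ℙ_W)`): with at least one `χ′`-direction under the
expectation, `|𝔼_W[Π_{w∈P}Φ(w)·(Π_D∂)χ·e^{−V}]| ≤ √𝔼_W[(Π_PΦ)²] · K_D · √ℙ_W(Sh)` — the shell PROBABILITY under the law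
of the fields of `W`. [cite: BalabanImbrieJaffe1988, §5.14 p.312] -/
theorem abs_integral_fieldLaw_le_shell (hPD : (prec blk Δ W (corner ℝ W)).PosDef) (c : ι → ℝ)
    (legs : ι → List ({x : α // blk x ∈ W} → ℝ)) {χ : ({x : α // blk x ∈ W} → ℝ) → ℝ} (hχ : ContDiff ℝ ∞ χ)
    {Kd : List ({x : α // blk x ∈ W} → ℝ) → ℝ} (hK : ∀ D φ, |dlist D χ φ * vexp c legs φ| ≤ Kd D)
    {Sh : Set ({x : α // blk x ∈ W} → ℝ)} (hSh : IsClosed Sh) (hχS : ∀ φ, φ ∉ Sh → fderiv ℝ χ φ = 0)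
    (P : Multiset ({x : α // blk x ∈ W} → ℝ)) {D : List ({x : α // blk x ∈ W} → ℝ)} (hD : D ≠ []) :
    |∫ φ, (P.map fun w => φ ⬝ᵥ w).prod * (dlist D χ φ * vexp c legs φ) ∂(fieldLaw blk Δ ℱ W)|
      ≤ Real.sqrt (∫ φ, (P.map fun w => φ ⬝ᵥ w).prod ^ 2 ∂(fieldLaw blk Δ ℱ W))
        * (Kd D * Real.sqrt (∫ φ, Sh.indicator (fun _ => (1 : ℝ)) φ ∂(fieldLaw blk Δ ℱ W))) := by
  have hZ := integral_density_pos blk Δ ℱ W hPD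
  have hsZ : Real.sqrt (∫ φ, weight (prec blk Δ W (corner ℝ W)) φ * source (src blk ℱ W) φ) ≠ 0 :=
    (Real.sqrt_pos.2 hZ).ne'
  have h := abs_gintM_le_shell (prec blk Δ W (corner ℝ W)) (src blk ℱ W) c legs hPD hχ hK hSh hχS P hD
  rw [gintM_eq_integral_prod] at h
  rw [integral_fieldLaw, integral_fieldLaw, integral_fieldLaw, abs_div, abs_of_pos hZ, div_le_iff₀ hZ,
    Real.sqrt_div' _ hZ.le, Real.sqrt_div' _ hZ.le]
  refine h.trans (le_of_eq ?_)
  field_simp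
  rw [Real.sq_sqrt hZ.le]

variable {blk Δ ℱ W}

/-- **The remainder observable on the law**: `remv(O)/Z = Σ_{t ∈ expand 0 O, no block} coef_t ·
𝔼_W[Π_{legs of t's X_r}Φ·(Π_{dirs t}∂)χ·e^{−V}]` (the inner sum of `BIJ88Resummation312Display.resummation312_fieldLaw`).
[cite: BalabanImbrieJaffe1988, §5.14 p.312] -/
theorem remv_div_eq_sum_fieldLaw (hPD : (prec blk Δ W (corner ℝ W)).PosDef) (c : ι → ℝ)
    (legs : ι → List ({x : α // blk x ∈ W} → ℝ)) (obs : κ → List ({x : α // blk x ∈ W} → ℝ)) (M : ℕ)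
    (χ : ({x : α // blk x ∈ W} → ℝ) → ℝ) (O : Finset κ) :
    remv (prec blk Δ W (corner ℝ W)) (src blk ℱ W) c legs obs M χ [] 0 O
        / ∫ φ, weight (prec blk Δ W (corner ℝ W)) φ * source (src blk ℱ W) φ
      = (((expand (prec blk Δ W (corner ℝ W)) (src blk ℱ W) c legs obs M 0 O).filter fun t => t.consts = 0).map
          fun t => t.coef * ∫ φ, ((t.groups.map fun h => (h.pend : Multiset _)).sum.map fun w => φ ⬝ᵥ w).prod
            * (dlist t.dirs χ φ * vexp c legs φ) ∂(fieldLaw blk Δ ℱ W)).sum := by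
  rw [remv, div_eq_mul_inv, ← Multiset.sum_map_mul_right]
  refine congrArg _ (Multiset.map_congr rfl fun t _ => ?_)
  rw [tval, List.nil_append, gintM_eq_mul_integral_fieldLaw blk Δ ℱ W hPD, mul_assoc, mul_comm (∫ φ, weight _ φ * _),
    mul_assoc, mul_inv_cancel₀ (integral_density_pos blk Δ ℱ W hPD).ne', mul_one]

/-- **THE REMAINDER OBSERVABLE ON THE LAW IS LARGE FACTORS TIMES ONE SMALL FACTOR** (p. 312, on the model of record):
for `O ≠ ∅`, cutoff `χ ∈ C^∞` with `χ′ = 0` off the closed shell `Sh`, brackets of `C = (prec)⁻¹` on `Dir` bounded by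
`B`, couplings `|c_m| ≤ c_M ≤ 1`, `W ≥ Φ₀(O) + Σ_m|legs m|`, and large-factor bounds on the law — `G` for the expectations
`|𝔼_W[Π_PΦ·(Π_D∂)χ·e^{−V}]|` and `G_s` for `√𝔼_W[(Π_PΦ)²]·K_D` (`D ≠ []`), over leg multisets `P ⊆ Dir` and direction
lists `D ⊆ C·Dir` of total size `≤ Φ₀(O)`:
`|Σ_{t: no block} coef_t 𝔼_W[Π_{P_t}Φ·(Π_{dirs t}∂)χ·e^{−V}]| ≤ (W·max B 1)^{Φ₀(O)} · max(c_M^{M}·G, G_s·√ℙ_W(Sh))`.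
[cite: BalabanImbrieJaffe1988, §5.14 p.312] -/
theorem abs_remv_le_fieldLaw (hPD : (prec blk Δ W (corner ℝ W)).PosDef) (c : ι → ℝ)
    (legs : ι → List ({x : α // blk x ∈ W} → ℝ)) {χ : ({x : α // blk x ∈ W} → ℝ) → ℝ} (hχ : ContDiff ℝ ∞ χ)
    {Kd : List ({x : α // blk x ∈ W} → ℝ) → ℝ} (hK : ∀ D φ, |dlist D χ φ * vexp c legs φ| ≤ Kd D)
    {Sh : Set ({x : α // blk x ∈ W} → ℝ)} (hSh : IsClosed Sh) (hχS : ∀ φ, φ ∉ Sh → fderiv ℝ χ φ = 0)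
    {Dir : Set ({x : α // blk x ∈ W} → ℝ)} {B cM : ℝ}
    (hB : ∀ u ∈ Dir, ∀ v ∈ Dir, |((prec blk Δ W (corner ℝ W))⁻¹ *ᵥ u) ⬝ᵥ v| ≤ B)
    (hBf : ∀ u ∈ Dir, |((prec blk Δ W (corner ℝ W))⁻¹ *ᵥ u) ⬝ᵥ src blk ℱ W| ≤ B)
    (hcM : 0 ≤ cM) (hcM1 : cM ≤ 1) (hcm : ∀ m, |c m| ≤ cM) {obs : κ → List ({x : α // blk x ∈ W} → ℝ)} {M : ℕ}
    (hobs : ∀ j, ∀ w ∈ obs j, w ∈ Dir) (hlegs : ∀ m, ∀ w ∈ legs m, w ∈ Dir) {O : Finset κ} (hO : O.Nonempty) {Wn : ℕ}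
    (hW : ∑ j ∈ O, ((obs j).length + 1 + M * maxArity legs) + ∑ m, (legs m).length ≤ Wn) {G Gs : ℝ} (hG0 : 0 ≤ G)
    (hG : ∀ (P : Multiset ({x : α // blk x ∈ W} → ℝ)) (D : List ({x : α // blk x ∈ W} → ℝ)), (∀ w ∈ P, w ∈ Dir) →
      (∀ z ∈ D, ∃ u ∈ Dir, (prec blk Δ W (corner ℝ W))⁻¹ *ᵥ u = z) →
      Multiset.card P + D.length ≤ ∑ j ∈ O, ((obs j).length + 1 + M * maxArity legs) →
        |∫ φ, (P.map fun w => φ ⬝ᵥ w).prod * (dlist D χ φ * vexp c legs φ) ∂(fieldLaw blk Δ ℱ W)| ≤ G)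
    (hGs : ∀ (P : Multiset ({x : α // blk x ∈ W} → ℝ)) (D : List ({x : α // blk x ∈ W} → ℝ)), (∀ w ∈ P, w ∈ Dir) →
      (∀ z ∈ D, ∃ u ∈ Dir, (prec blk Δ W (corner ℝ W))⁻¹ *ᵥ u = z) →
      Multiset.card P + D.length ≤ ∑ j ∈ O, ((obs j).length + 1 + M * maxArity legs) → D ≠ [] →
        Real.sqrt (∫ φ, (P.map fun w => φ ⬝ᵥ w).prod ^ 2 ∂(fieldLaw blk Δ ℱ W)) * Kd D ≤ Gs) :
    |(((expand (prec blk Δ W (corner ℝ W)) (src blk ℱ W) c legs obs M 0 O).filter fun t => t.consts = 0).map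
        fun t => t.coef * ∫ φ, ((t.groups.map fun h => (h.pend : Multiset _)).sum.map fun w => φ ⬝ᵥ w).prod
          * (dlist t.dirs χ φ * vexp c legs φ) ∂(fieldLaw blk Δ ℱ W)).sum|
      ≤ ((Wn : ℝ) * max B 1) ^ (∑ j ∈ O, ((obs j).length + 1 + M * maxArity legs))
        * max (cM ^ M * G) (Gs * Real.sqrt (∫ φ, Sh.indicator (fun _ => (1 : ℝ)) φ ∂(fieldLaw blk Δ ℱ W))) := by
  -- abbreviations written out: A = prec …, f = src …, Z = ∫ weight·source
  have hZ := integral_density_pos blk Δ ℱ W hPD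
  have hsZ : 0 ≤ Real.sqrt (∫ φ, weight (prec blk Δ W (corner ℝ W)) φ * source (src blk ℱ W) φ) := Real.sqrt_nonneg _
  -- the unnormalized large factors
  have hG' : ∀ (P : Multiset ({x : α // blk x ∈ W} → ℝ)) (D : List ({x : α // blk x ∈ W} → ℝ)), (∀ w ∈ P, w ∈ Dir) →
      (∀ z ∈ D, ∃ u ∈ Dir, (prec blk Δ W (corner ℝ W))⁻¹ *ᵥ u = z) →
      Multiset.card P + D.length ≤ ∑ j ∈ O, ((obs j).length + 1 + M * maxArity legs) →
        |gintM (prec blk Δ W (corner ℝ W)) (src blk ℱ W) c legs χ P D|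
          ≤ (∫ φ, weight (prec blk Δ W (corner ℝ W)) φ * source (src blk ℱ W) φ) * G := by
    intro P D hP hD hsz
    rw [gintM_eq_mul_integral_fieldLaw blk Δ ℱ W hPD, abs_mul, abs_of_pos hZ]
    exact mul_le_mul_of_nonneg_left (hG P D hP hD hsz) hZ.le
  have hGs' : ∀ (P : Multiset ({x : α // blk x ∈ W} → ℝ)) (D : List ({x : α // blk x ∈ W} → ℝ)), (∀ w ∈ P, w ∈ Dir) →
      (∀ z ∈ D, ∃ u ∈ Dir, (prec blk Δ W (corner ℝ W))⁻¹ *ᵥ u = z) →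
      Multiset.card P + D.length ≤ ∑ j ∈ O, ((obs j).length + 1 + M * maxArity legs) → D ≠ [] →
        Real.sqrt (∫ φ, (P.map fun w => φ ⬝ᵥ w).prod ^ 2
            * (weight (prec blk Δ W (corner ℝ W)) φ * source (src blk ℱ W) φ)) * Kd D
          ≤ Real.sqrt (∫ φ, weight (prec blk Δ W (corner ℝ W)) φ * source (src blk ℱ W) φ) * Gs := by
    intro P D hP hD hsz hne
    have hKd : 0 ≤ Kd D := (abs_nonneg _).trans (hK D 0)
    have e : ∫ φ, (P.map fun w => φ ⬝ᵥ w).prod ^ 2 * (weight (prec blk Δ W (corner ℝ W)) φ * source (src blk ℱ W) φ)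
        = (∫ φ, weight (prec blk Δ W (corner ℝ W)) φ * source (src blk ℱ W) φ)
          * ∫ φ, (P.map fun w => φ ⬝ᵥ w).prod ^ 2 ∂(fieldLaw blk Δ ℱ W) := by
      rw [integral_fieldLaw, mul_div_cancel₀ _ hZ.ne']
    rw [e, Real.sqrt_mul hZ.le, mul_assoc]
    exact mul_le_mul_of_nonneg_left (hGs P D hP hD hsz hne) hsZ
  have h := abs_remv_le hPD hχ hK hSh hχS hB hBf hcM hcM1 hcm hobs hlegs hO hW (mul_nonneg hZ.le hG0) hG' hGs'
  -- pass to the law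
  rw [← remv_div_eq_sum_fieldLaw hPD c legs obs M χ O, abs_div, abs_of_pos hZ, div_le_iff₀ hZ]
  refine h.trans ?_
  have eSh : ∫ φ, Sh.indicator (fun _ => (1 : ℝ)) φ * (weight (prec blk Δ W (corner ℝ W)) φ * source (src blk ℱ W) φ)
      = (∫ φ, weight (prec blk Δ W (corner ℝ W)) φ * source (src blk ℱ W) φ)
        * ∫ φ, Sh.indicator (fun _ => (1 : ℝ)) φ ∂(fieldLaw blk Δ ℱ W) := by
    rw [integral_fieldLaw, mul_div_cancel₀ _ hZ.ne']
  rw [eSh, Real.sqrt_mul hZ.le, mul_assoc (((Wn : ℝ) * max B 1) ^ _)]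
  refine mul_le_mul_of_nonneg_left (max_le ?_ ?_)
    (pow_nonneg (mul_nonneg (Nat.cast_nonneg _) (zero_le_one.trans (le_max_right _ _))) _)
  · calc cM ^ M * ((∫ φ, weight (prec blk Δ W (corner ℝ W)) φ * source (src blk ℱ W) φ) * G)
        = cM ^ M * G * ∫ φ, weight (prec blk Δ W (corner ℝ W)) φ * source (src blk ℱ W) φ := by ring
      _ ≤ _ := mul_le_mul_of_nonneg_right (le_max_left _ _) hZ.le
  · calc Real.sqrt (∫ φ, weight (prec blk Δ W (corner ℝ W)) φ * source (src blk ℱ W) φ) * Gs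
          * (Real.sqrt (∫ φ, weight (prec blk Δ W (corner ℝ W)) φ * source (src blk ℱ W) φ)
            * Real.sqrt (∫ φ, Sh.indicator (fun _ => (1 : ℝ)) φ ∂(fieldLaw blk Δ ℱ W)))
        = Gs * Real.sqrt (∫ φ, Sh.indicator (fun _ => (1 : ℝ)) φ ∂(fieldLaw blk Δ ℱ W))
          * (Real.sqrt (∫ φ, weight (prec blk Δ W (corner ℝ W)) φ * source (src blk ℱ W) φ)
            * Real.sqrt (∫ φ, weight (prec blk Δ W (corner ℝ W)) φ * source (src blk ℱ W) φ)) := by ring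
      _ = Gs * Real.sqrt (∫ φ, Sh.indicator (fun _ => (1 : ℝ)) φ ∂(fieldLaw blk Δ ℱ W))
          * ∫ φ, weight (prec blk Δ W (corner ℝ W)) φ * source (src blk ℱ W) φ := by rw [Real.mul_self_sqrt hZ.le]
      _ ≤ _ := mul_le_mul_of_nonneg_right (le_max_right _ _) hZ.le

end Law

end Literature.MathematicalPhysics.QuantumFieldTheory.BalabanImbrieJaffe1984to88.BIJ88LabelledRemainderFieldLaw312

end
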